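import Mathlib
import Summits.ValiantsHypothesis.ValiantsHypothesis.Theorems.LacunarySymmetroidMatrixDescartesDefiniteMomentsZones

/-!
# `DoorA26` (stmt-ValiantsHypothesis-19979) — partial-range row: the door's inequality on the INTRINSIC hyperbolic sector

HONEST FRAMING.  Cell `pub-symmetroid`, seat `val-sym-mdr-p2` (gen 15); helper file `--supports` the door item
stmt-ValiantsHypothesis-19979 (`DoorA26 = PosRootLawAt 2 6 19`), NO closure claim: a PARTIAL-RANGE row.  On six-term real
symmetric `2 × 2` lacunary pencils at strictly increasing exponents whose every Rayleigh 6-nomial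
`∑ₗ (vᵀSₗv) X^{dₗ}` (`v ≠ 0`) has `5` distinct positive roots (the intrinsic hyperbolic sector of
`…DefiniteMomentsZones`), the determinant has at most `10 = (K−1)·m` distinct positive zeros, so the door's `19` holds there
with room.  The door itself (all pencils) stays OPEN; registers unchanged; nothing on VP ≠ VNP. [folklore]
-/

-- layout Summits/ValiantsHypothesis/ValiantsHypothesis forces the duplicated namespace component
set_option linter.dupNamespace false

namespace Summit.ValiantsHypothesis.ValiantsHypothesis.Theorems.LacunarySymmetroidMatrixDescartes

open Polynomial Matrix Finset
open scoped BigOperators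

namespace DefiniteMoments

/-- **DoorA26 on the intrinsic hyperbolic sector.**  A six-term real symmetric `2 × 2` lacunary pencil at strictly
increasing exponents, every Rayleigh 6-nomial of which has five distinct positive roots, has at most `10` distinct positive
determinant zeros. [folklore] -/
theorem doorA26_on_intrinsicSector (d : Fin 6 → ℕ) (hd : StrictMono d) (S : Fin 6 → Matrix (Fin 2) (Fin 2) ℝ)
    (hS : ∀ l, (S l).IsSymm)
    (hsharp : ∀ v : Fin 2 → ℝ, v ≠ 0 →
      6 ≤ ((∑ l, C (v ⬝ᵥ (S l *ᵥ v)) * (X : ℝ[X]) ^ d l).roots.toFinset.filter (fun t => 0 < t)).card + 1) :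
    ((∑ l, (Polynomial.X : Polynomial ℝ) ^ d l • (S l).map Polynomial.C).det.roots.toFinset.filter
        (fun t => 0 < t)).card ≤ 10 := by
  have h := card_posRoots_le_of_rayleighSharp (by norm_num) d hd S hS hsharp
  simpa using h

/-- Hence the door's inequality `≤ 19` on that sector. [folklore] -/
theorem doorA26_ineq_on_intrinsicSector (d : Fin 6 → ℕ) (hd : StrictMono d) (S : Fin 6 → Matrix (Fin 2) (Fin 2) ℝ)
    (hS : ∀ l, (S l).IsSymm)
    (hsharp : ∀ v : Fin 2 → ℝ, v ≠ 0 →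
      6 ≤ ((∑ l, C (v ⬝ᵥ (S l *ᵥ v)) * (X : ℝ[X]) ^ d l).roots.toFinset.filter (fun t => 0 < t)).card + 1) :
    ((∑ l, (Polynomial.X : Polynomial ℝ) ^ d l • (S l).map Polynomial.C).det.roots.toFinset.filter
        (fun t => 0 < t)).card ≤ 19 :=
  (doorA26_on_intrinsicSector d hd S hS hsharp).trans (by norm_num)

end DefiniteMoments

end Summit.ValiantsHypothesis.ValiantsHypothesis.Theorems.LacunarySymmetroidMatrixDescartes
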